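import Mathlib
import HarnessLib

/-!
# Crux `WeakCouplingHypercubicLimitRP` (stmt-QuantumFields-27398), line `Sketch`, stub D1 `stub_diagRPOfPlaneLimits`,
# door B: the finite-dimensional support lemmas of cards #109 / #110 (twist split, strict Perron top)

Helper file (`--supports stmt-QuantumFields-27398 --as helper`) of the crux lead `lead-27398-D1`, door B (sign-twisted diagonal
trace; critic idea-crit-9 g12 r2 synthesis «support items provable now: the finite-dim split lemma (#109 p2), PerronStrict∕StrictTop
(#110 q1)»).  Pure `Matrix` algebra over `ℝ`; the cards' bundling definitions (`SliceData`, `PrincipalSignGap`, `OddMomentumGap`,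
`OddTwistGapFD`, `StrictTop`, `TwoStepGap`, `PerronStrict` of `Sketch-spectral-transfer.lean`, r2 seat 1) are UNFOLDED into the
hypotheses, so nothing is re-declared and no `def` is introduced.

Finite-dimensional currency of the door-B core (`Theorems/DiagonalMirrorRPRTwistedTrace.lean`): the odd-torus diagonal one-step
operator is a real matrix `K` commuting with the slice translation `W` (`W ^ S = 1`, `S` odd, `W` orthogonal); the symmetric
operator of record is `K₁ := K * W ^ ((S+1)/2)`, the twist is `U := sgn K₁`, and R1 `OddTwistGap` at one `k` says: every NEGATIVE
eigenvalue `κ` of `K₁` has `|κ| ≤ ε λ₀`.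

* `oddTwistGap_of_twoStepGap` (#110, first lemma of IDEA 2): top bound `|κ| ≤ λ₀` + strict top (`−λ₀ ∉ spec K₁`) + the sign-free
  two-step gap (`|κ| < λ₀ ⇒ |κ| ≤ ε λ₀`) ⇒ the odd-twist gap — three lines of case analysis, stated for any real matrix `K₁`.
* `oddTwistGap_of_principalSplit` (#109, first lemma of IDEA 1, «the finite-dim split lemma»): with `R` a square root of `W`
  commuting with `K` and `W` (`R R = W`, `R Rᵀ = 1`), the EXACT factorisation `K₁ = K_pr E = E K_pr`, `K_pr := K R`,
  `E := Rᵀ W^{(S+1)/2}`, `E² = 1` (`S` odd) splits an eigenvector `v` of `K₁` into `v ± E v`, joint eigenvectors of `(K_pr, E)`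
  with eigenvalues `(κ, +1)` and `(−κ, −1)`; the cutoff-scale letter L_a `PrincipalSignGap` (negative eigenvalues of `K_pr` are
  `≤ e^{−c} λ₀`) handles the first, the physical letter L_b `OddMomentumGap` (odd-parity eigenvectors of `K_pr` are `≤ ε λ₀`) the
  second, and `e^{−c} ≤ ε` compares the scales.  (`Kᵀ = K W` and positivity of `R + Rᵀ` from `SliceData` are not needed.)
* `perronStrict` (#110, the named classical fact `PerronStrict d`, Perron 1907 / Frobenius 1912, finite-dimensional form): a real
  matrix with strictly positive entries and a strictly positive eigenvector for `ρ` has every other real eigenvalue of modulus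
  `< ρ` (in particular `−ρ` is not an eigenvalue) — the max-ratio argument `t = max_i |v_i| / w_i`.

HONEST FRAMING: bookkeeping for door B's letters; nothing here is a statement about Wilson's measure; ⟨27398⟩, its stubs S6i and
D1, and ⟨10604⟩ are OPEN; the Yang–Mills mass gap is NOT proved here or anywhere in the tree.

References: O. Perron, Math. Ann. 64 (1907) 248–263; G. Frobenius, S.-B. Preuss. Akad. Wiss. (1912) 456–477; E. Seneta,
*Non-negative Matrices and Markov Chains* (Springer, 1981) Thm 1.1; cards `idea-principal-branch-twist-split.md`,
`idea-strict-perron-two-step-gap.md` (cruxidea-10604-r2 seat 1).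
-/

set_option autoImplicit false

namespace Summit.QuantumFields.YangMills.Theorems.WeakCouplingHypercubicLimitRP.TwistSplit

open Matrix

variable {d : ℕ}

/-- **#110, first lemma of IDEA 2 (`stub_oddTwistGap_of_twoStepGap`, definitions unfolded).**  For a real matrix `K₁` with
top bound `λ₀` on its real spectrum, a STRICT top (`K₁ v = −λ₀ v ⇒ v = 0`) and the sign-free two-step gap
(`|κ| < λ₀ ⇒ |κ| ≤ ε λ₀`), every negative eigenvalue `κ` satisfies `|κ| ≤ ε λ₀` (the odd-twist gap `OddTwistGapFD`). -/
theorem oddTwistGap_of_twoStepGap (K₁ : Matrix (Fin d) (Fin d) ℝ) (ε lam0 : ℝ)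
    (htop : ∀ (κ : ℝ) (v : Fin d → ℝ), v ≠ 0 → K₁ *ᵥ v = κ • v → |κ| ≤ lam0)
    (hs : ∀ v : Fin d → ℝ, K₁ *ᵥ v = (-lam0) • v → v = 0)
    (hg : ∀ (κ : ℝ) (v : Fin d → ℝ), v ≠ 0 → K₁ *ᵥ v = κ • v → |κ| < lam0 → |κ| ≤ ε * lam0) :
    ∀ (κ : ℝ) (v : Fin d → ℝ), v ≠ 0 → K₁ *ᵥ v = κ • v → κ < 0 → |κ| ≤ ε * lam0 := by
  intro κ v hv hKv hκ
  rcases (htop κ v hv hKv).lt_or_eq with hlt | heq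
  · exact hg κ v hv hKv hlt
  · exfalso
    have hκ' : κ = -lam0 := by rw [abs_of_neg hκ] at heq; linarith
    subst hκ'
    exact hv (hs v hKv)

/-- **#109, first lemma of IDEA 1 (`stub_oddTwistGap_of_principalSplit`, «the finite-dim split lemma», definitions unfolded).**
`K, W, R` real `d × d` matrices, `S` odd: `W` orthogonal with `W ^ S = 1`, `R` an orthogonal square root of `W` commuting with `K`
and `W`, `[K, W] = 0`.  If every negative eigenvalue of the principal step `K_pr = K R` has modulus `≤ e^{−c} λ₀` (L_a,
`PrincipalSignGap`) and every eigenvector of `K_pr` of odd momentum parity (`E v = −v`, `E = Rᵀ W^{(S+1)/2}`) has modulus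
`≤ ε λ₀` (L_b, `OddMomentumGap`), and `e^{−c} ≤ ε`, `0 ≤ λ₀`, then every negative eigenvalue of the operator of record
`K₁ = K W^{(S+1)/2}` has modulus `≤ ε λ₀` (`OddTwistGapFD`).  Proof: `K₁ = K_pr E = E K_pr`, `E² = 1`; split `v = v₊ + v₋`. -/
theorem oddTwistGap_of_principalSplit (K W R : Matrix (Fin d) (Fin d) ℝ) (S : ℕ) (c ε lam0 : ℝ) (hS : Odd S)
    (hRt : R * Rᵀ = 1) (hRR : R * R = W) (hWt : W * Wᵀ = 1) (hWS : W ^ S = 1)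
    (hKW : K * W = W * K) (hKR : K * R = R * K) (hWR : W * R = R * W)
    (ha : ∀ (κ : ℝ) (v : Fin d → ℝ), v ≠ 0 → (K * R) *ᵥ v = κ • v → κ < 0 → |κ| ≤ Real.exp (-c) * lam0)
    (hb : ∀ (κ : ℝ) (v : Fin d → ℝ), v ≠ 0 → (K * R) *ᵥ v = κ • v →
      (Rᵀ * W ^ ((S + 1) / 2)) *ᵥ v = -v → |κ| ≤ ε * lam0)
    (hcε : Real.exp (-c) ≤ ε) (hlam : 0 ≤ lam0) :
    ∀ (κ : ℝ) (v : Fin d → ℝ), v ≠ 0 → (K * W ^ ((S + 1) / 2)) *ᵥ v = κ • v → κ < 0 → |κ| ≤ ε * lam0 := by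
  -- notation
  set h : ℕ := (S + 1) / 2 with hh
  set P : Matrix (Fin d) (Fin d) ℝ := K * R with hP
  set E : Matrix (Fin d) (Fin d) ℝ := Rᵀ * W ^ h with hE
  -- algebra: `Rᵀ R = 1`, `Wᵀ W = 1`, commutations of the powers
  have hRtR : Rᵀ * R = 1 := mul_eq_one_comm.1 hRt
  have hWtW : Wᵀ * W = 1 := mul_eq_one_comm.1 hWt
  have hKWh : K * W ^ h = W ^ h * K := (Commute.pow_right (show Commute K W from hKW) h).eq
  have hWhR : W ^ h * R = R * W ^ h := (Commute.pow_left (show Commute W R from hWR) h).eq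
  have hRtWh : Rᵀ * W ^ h = W ^ h * Rᵀ := by
    calc Rᵀ * W ^ h = Rᵀ * W ^ h * (R * Rᵀ) := by rw [hRt, Matrix.mul_one]
      _ = Rᵀ * (W ^ h * R) * Rᵀ := by simp only [Matrix.mul_assoc]
      _ = Rᵀ * (R * W ^ h) * Rᵀ := by rw [hWhR]
      _ = (Rᵀ * R) * W ^ h * Rᵀ := by simp only [Matrix.mul_assoc]
      _ = W ^ h * Rᵀ := by rw [hRtR, Matrix.one_mul]
  have h2h : 2 * h = S + 1 := by
    obtain ⟨j, rfl⟩ := hS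
    omega
  have hW2h : W ^ h * W ^ h = W := by
    rw [← pow_add, ← two_mul, h2h, pow_succ, hWS, Matrix.one_mul]
  -- `P E = K₁`, `E P = K₁`, `E E = 1`
  have hPE : P * E = K * W ^ h := by
    calc P * E = K * (R * Rᵀ) * W ^ h := by simp only [hP, hE, Matrix.mul_assoc]
      _ = K * W ^ h := by rw [hRt, Matrix.mul_one]
  have hEP : E * P = K * W ^ h := by
    calc E * P = Rᵀ * (W ^ h * K) * R := by simp only [hP, hE, Matrix.mul_assoc]
      _ = Rᵀ * (K * W ^ h) * R := by rw [hKWh]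
      _ = Rᵀ * K * (W ^ h * R) := by simp only [Matrix.mul_assoc]
      _ = Rᵀ * K * (R * W ^ h) := by rw [hWhR]
      _ = Rᵀ * P * W ^ h := by simp only [hP, Matrix.mul_assoc]
      _ = Rᵀ * (R * K) * W ^ h := by rw [hKR]
      _ = (Rᵀ * R) * K * W ^ h := by simp only [Matrix.mul_assoc]
      _ = K * W ^ h := by rw [hRtR, Matrix.one_mul]
  have hEE : E * E = 1 := by
    calc E * E = Rᵀ * (W ^ h * Rᵀ) * W ^ h := by simp only [hE, Matrix.mul_assoc]
      _ = Rᵀ * (Rᵀ * W ^ h) * W ^ h := by rw [hRtWh]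
      _ = (Rᵀ * Rᵀ) * (W ^ h * W ^ h) := by simp only [Matrix.mul_assoc]
      _ = (R * R)ᵀ * W := by rw [hW2h, Matrix.transpose_mul]
      _ = 1 := by rw [hRR, hWtW]
  -- the split
  intro κ v hv hKv hκ
  have hPv : P *ᵥ v = κ • (E *ᵥ v) := by
    have : P = E * (K * W ^ h) := by rw [← hEP, ← Matrix.mul_assoc, hEE, Matrix.one_mul]
    rw [this, ← mulVec_mulVec, hKv, mulVec_smul]
  have hPEv : P *ᵥ (E *ᵥ v) = κ • v := by rw [mulVec_mulVec, hPE, hKv]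
  have hEEv : E *ᵥ (E *ᵥ v) = v := by rw [mulVec_mulVec, hEE, one_mulVec]
  by_cases hplus : v + E *ᵥ v = 0
  · -- odd parity: `E v = -v`, `P v = (-κ) v`
    have hEv : E *ᵥ v = -v := eq_neg_of_add_eq_zero_right hplus
    have hPv' : P *ᵥ v = (-κ) • v := by rw [hPv, hEv, smul_neg, neg_smul]
    have := hb (-κ) v hv hPv' hEv
    rwa [abs_neg] at this
  · -- even component `v + E v ≠ 0` is an eigenvector of `P` with eigenvalue `κ < 0`
    have hPw : P *ᵥ (v + E *ᵥ v) = κ • (v + E *ᵥ v) := by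
      rw [mulVec_add, hPv, hPEv, smul_add, add_comm]
    exact (ha κ _ hplus hPw hκ).trans (mul_le_mul_of_nonneg_right hcε hlam)

/-- **#110, the named classical fact `PerronStrict d` (Perron–Frobenius, finite-dimensional strict form).**  A real `d × d` matrix
with strictly positive entries and a strictly positive eigenvector `w` for `ρ` has every other real eigenvalue `μ ≠ ρ` of modulus
`|μ| < ρ`; in particular `−ρ` is not an eigenvalue.  Proof: with `t = max_i |v_i| / w_i > 0` one has `|v| ≤ t w` entrywise, so at a
maximising index `|μ| t w_i = |(P v)_i| ≤ (P |v|)_i ≤ t ρ w_i`, i.e. `|μ| ≤ ρ`; equality forces `|v| = t w` and all `P_{ij} v_j` of one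
sign, i.e. `v = ± t w` and `μ = ρ`. -/
theorem perronStrict (P : Matrix (Fin d) (Fin d) ℝ) (hP : ∀ i j, 0 < P i j) (ρ μ : ℝ) (w v : Fin d → ℝ)
    (hw : ∀ i, 0 < w i) (hPw : P *ᵥ w = ρ • w) (hv : v ≠ 0) (hPv : P *ᵥ v = μ • v) (hμ : μ ≠ ρ) : |μ| < ρ := by
  classical
  -- a maximising index for the ratios `|v i| / w i`
  obtain ⟨j₀, hj₀⟩ : ∃ j, v j ≠ 0 := Function.ne_iff.1 hv
  have hne : (Finset.univ : Finset (Fin d)).Nonempty := ⟨j₀, Finset.mem_univ _⟩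
  obtain ⟨i₀, -, hi₀⟩ := Finset.exists_max_image Finset.univ (fun i => |v i| / w i) hne
  set t : ℝ := |v i₀| / w i₀ with ht
  have hle : ∀ j, |v j| ≤ t * w j := fun j => by
    have := hi₀ j (Finset.mem_univ j)
    rwa [div_le_iff₀ (hw j)] at this
  have ht0 : 0 < t := by
    have h1 : 0 < |v j₀| / w j₀ := div_pos (abs_pos.2 hj₀) (hw j₀)
    exact h1.trans_le (hi₀ j₀ (Finset.mem_univ _))
  have hvi₀ : |v i₀| = t * w i₀ := by rw [ht, div_mul_cancel₀ _ (hw i₀).ne']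
  -- components of the eigen-equations
  have hPw_i : ∀ i, ∑ j, P i j * w j = ρ * w i := fun i => by
    have := congrFun hPw i
    simpa [mulVec, dotProduct] using this
  have hPv_i : ∀ i, ∑ j, P i j * v j = μ * v i := fun i => by
    have := congrFun hPv i
    simpa [mulVec, dotProduct] using this
  -- the key chain at `i₀`: `|μ| t w_{i₀} ≤ Σ P |v| ≤ t ρ w_{i₀}`
  have hsum_abs : |∑ j, P i₀ j * v j| ≤ ∑ j, P i₀ j * |v j| := by
    refine (Finset.abs_sum_le_sum_abs _ _).trans (le_of_eq ?_)
    refine Finset.sum_congr rfl fun j _ => ?_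
    rw [abs_mul, abs_of_pos (hP i₀ j)]
  have hsum_le : ∑ j, P i₀ j * |v j| ≤ ∑ j, P i₀ j * (t * w j) :=
    Finset.sum_le_sum fun j _ => mul_le_mul_of_nonneg_left (hle j) (hP i₀ j).le
  have hsum_eq : ∑ j, P i₀ j * (t * w j) = t * (ρ * w i₀) := by
    rw [← hPw_i i₀, Finset.mul_sum]
    refine Finset.sum_congr rfl fun j _ => ?_
    ring
  have hchain : |μ| * (t * w i₀) ≤ ρ * (t * w i₀) := by
    calc |μ| * (t * w i₀) = |∑ j, P i₀ j * v j| := by rw [hPv_i, abs_mul, hvi₀]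
      _ ≤ ∑ j, P i₀ j * (t * w j) := hsum_abs.trans hsum_le
      _ = ρ * (t * w i₀) := by rw [hsum_eq]; ring
  have htw : 0 < t * w i₀ := mul_pos ht0 (hw i₀)
  have hle_ρ : |μ| ≤ ρ := le_of_mul_le_mul_right hchain htw
  -- strictness
  refine lt_of_le_of_ne hle_ρ fun heq => hμ ?_
  -- equality in the chain: `Σ P (t w − |v|) = 0` and `|Σ P v| = Σ P |v|`
  have hchain_eq : |∑ j, P i₀ j * v j| = ∑ j, P i₀ j * (t * w j) := by
    refine le_antisymm (hsum_abs.trans hsum_le) ?_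
    rw [hsum_eq, hPv_i, abs_mul, hvi₀, heq]
    exact le_of_eq (by ring)
  have habs_eq : ∀ j, |v j| = t * w j := by
    have hzero : ∑ j, P i₀ j * (t * w j - |v j|) = 0 := by
      have h1 : ∑ j, P i₀ j * (t * w j - |v j|) = ∑ j, P i₀ j * (t * w j) - ∑ j, P i₀ j * |v j| := by
        rw [← Finset.sum_sub_distrib]
        exact Finset.sum_congr rfl fun j _ => by ring
      rw [h1]
      linarith [hsum_abs, hsum_le, hchain_eq]
    have hnn : ∀ j ∈ (Finset.univ : Finset (Fin d)), 0 ≤ P i₀ j * (t * w j - |v j|) :=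
      fun j _ => mul_nonneg (hP i₀ j).le (sub_nonneg.2 (hle j))
    intro j
    have hj := (Finset.sum_eq_zero_iff_of_nonneg hnn).1 hzero j (Finset.mem_univ j)
    rcases mul_eq_zero.1 hj with h0 | h0
    · exact absurd h0 (hP i₀ j).ne'
    · linarith
  -- all `P i₀ j * v j` have one sign: `v = t w` or `v = -t w`
  have hsign : (∀ j, v j = t * w j) ∨ (∀ j, v j = -(t * w j)) := by
    have htri : |∑ j, P i₀ j * v j| = ∑ j, |P i₀ j * v j| := by
      rw [hchain_eq]
      refine Finset.sum_congr rfl fun j _ => ?_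
      rw [abs_mul, abs_of_pos (hP i₀ j), habs_eq j]
    rcases le_or_gt 0 (∑ j, P i₀ j * v j) with hpos | hneg
    · left
      have hz : ∑ j, (|P i₀ j * v j| - P i₀ j * v j) = 0 := by
        rw [Finset.sum_sub_distrib, ← htri, abs_of_nonneg hpos, sub_self]
      have hnn : ∀ j ∈ (Finset.univ : Finset (Fin d)), 0 ≤ |P i₀ j * v j| - P i₀ j * v j :=
        fun j _ => sub_nonneg.2 (le_abs_self _)
      intro j
      have hj := (Finset.sum_eq_zero_iff_of_nonneg hnn).1 hz j (Finset.mem_univ j)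
      have h3 : 0 ≤ P i₀ j * v j := by linarith [abs_nonneg (P i₀ j * v j)]
      have hvj : 0 ≤ v j := (mul_nonneg_iff_of_pos_left (hP i₀ j)).1 h3
      rw [← abs_of_nonneg hvj]
      exact habs_eq j
    · right
      have hz : ∑ j, (|P i₀ j * v j| + P i₀ j * v j) = 0 := by
        rw [Finset.sum_add_distrib, ← htri, abs_of_neg hneg, neg_add_cancel]
      have hnn : ∀ j ∈ (Finset.univ : Finset (Fin d)), 0 ≤ |P i₀ j * v j| + P i₀ j * v j :=
        fun j _ => by linarith [neg_abs_le (P i₀ j * v j)]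
      intro j
      have hj := (Finset.sum_eq_zero_iff_of_nonneg hnn).1 hz j (Finset.mem_univ j)
      have h3 : 0 ≤ P i₀ j * (-v j) := by
        rw [mul_neg]
        linarith [abs_nonneg (P i₀ j * v j)]
      have hvj : 0 ≤ -v j := (mul_nonneg_iff_of_pos_left (hP i₀ j)).1 h3
      have h4 : v j = -|v j| := by rw [abs_of_nonpos (by linarith), neg_neg]
      rw [h4, habs_eq j]
  -- hence `μ v = P v = ± t P w = ρ v`, so `μ = ρ`
  have hvtw : ∃ s : ℝ, s ≠ 0 ∧ v = s • w := by
    rcases hsign with hs | hs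
    · exact ⟨t, ht0.ne', funext fun j => by simp [hs j]⟩
    · exact ⟨-t, neg_ne_zero.2 ht0.ne', funext fun j => by simp [hs j, neg_mul]⟩
  obtain ⟨s, hs0, hvs⟩ := hvtw
  have h1 : μ • v = ρ • v := by
    rw [← hPv, hvs, mulVec_smul, hPw, smul_comm]
  have h2 : (μ - ρ) • v = 0 := by rw [sub_smul, h1, sub_self]
  rcases smul_eq_zero.1 h2 with h3 | h3
  · linarith
  · exact absurd h3 hv

end Summit.QuantumFields.YangMills.Theorems.WeakCouplingHypercubicLimitRP.TwistSplit
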